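import Mathlib
import Summits.CriticalPhenomena.CardyFormulaZ2.Theorems.CardyFlipRussoSquareFromVoronoiHubDefs
import Summits.CriticalPhenomena.CardyFormulaZ2.Theorems.CardyFlipRussoSquareFromVoronoiHubFaithfulPart2
import Summits.CriticalPhenomena.CardyFormulaZ2.Theorems.CardyFlipRussoSquareFromVoronoiHubFaithfulPart4
import Summits.CriticalPhenomena.CardyFormulaZ2.Theorems.CardyFlipRussoSquareFromVoronoiHubFaithfulPart5
import Summits.CriticalPhenomena.CardyFormulaZ2.Theorems.CardyFlipRussoSquareFromVoronoiHubFaithfulPart6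
import Summits.CriticalPhenomena.CardyFormulaZ2.Theorems.CardyFlipRussoSquareFromVoronoiHubFaithfulPart7
import Summits.CriticalPhenomena.CardyFormulaZ2.Theorems.CardyFlipRussoSquareFromVoronoiHubFaithfulPart8
import Summits.CriticalPhenomena.CardyFormulaZ2.Theorems.CardyFlipRussoSquareFromVoronoiHubSandwichPart1
import Literature.Probability.Percolation.VoronoiCrossing
import Literature.Probability.Percolation.SitePaths
import HarnessLib

/-!
# Stub `stub_lowerCrossing` of line `Sketch` (r2 k4, card `poissonised-chessboard`),
# crux `SquareFromVoronoiHub`: the lower inclusion of the chessboard-endpoint sandwich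

Crux `Summit.CriticalPhenomena.CardyFormulaZ2.Theses.CardyFlipRusso.SquareFromVoronoiHub`
(stmt-CriticalPhenomena-6434, route `CardyFlipRusso`; lead c4 skeleton
`Cruxes/SquareFromVoronoiHub/Lines/Sketch.lean`), line `Sketch` (r2 k4, card
`poissonised-chessboard`), registered stub `stub_lowerCrossing`: the DETERMINISTIC lower
inclusion (S4) of the chessboard-endpoint sandwich.

Setting: an abstract block map `β : ℂ → (ℤ × ℤ) ⊕ (ℤ × ℤ)` at mesh `δ` (every point within
`3δ/5` of the site `δ • zGs (β p)` of its block, points at distance `≤ δ/4` in equal or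
`Gs`-adjacent blocks), nuclei `K` coloured by the coins `ω₂` (black nuclei
`B = {p ∈ K | β p ∈ ω₂}`, white nuclei `W = {p ∈ K | β p ∉ ω₂}`), `δ/16`-dense on a set
`V ⊇ closure R₁`; `R` the conformal rectangle of interest and `R₁` the LOWER perturbed rectangle
with caps `F₀` (beyond `(ab)`), `F₂` (beyond `(cd)`) and margin `r > δ` (the nine cap/collar
clauses of `lowerMargins R R₁ F₀ F₂`, verbatim those of K1's
`blockConfig_mem_crudeCrossing_of_tube`), and the separation clause "nothing is within `δ` of
both `(ab)` and `(cd)`".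

* `mem_crudeCrossing_of_blackPath_of_chain` (**S4, lower inclusion**): GIVEN the block-chain
  lemma (registered separately as `stub_blockChain`; here the hypothesis `hchain`: a black
  sub-path `γ|[a,b]` inside `V` is shadowed within `7δ/10` by a `Gs`-path of `ω₂`-open sites,
  with endpoints within `7δ/10` of `γ(a)`, `γ(b)`), a BLACK continuum crossing `γ ⊆ closure R₁`
  of `R₁` from `R₁.arc 0` to `R₁.arc 2` puts the coin configuration `ω₂` in the crude event
  `crudeCrossing R δ`.  Proof (twin of K1 Part 6 + SandwichPart1): `γ` starts off `closure Ω` in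
  `F₀` and ends off `closure Ω` in `F₂`, so it meets `(cd)` (`exists_mem_arc_two_of_split`);
  truncate it at its first entry through `(ab)` (`exists_first_entry`); Part 7's
  `exists_collar_exit` (topological input: Part 4's `exists_mem_closure_of_split`) yields a
  sub-path `[a, b]` from within `δ` of `(ab)` to within `δ` of `(cd)` running `≥ δ` inside `Ω`;
  the block chain shadowing it has all sites within `7δ/10 < δ` of it, hence in `Ω`
  (`mem_of_dist_lt_infDist_frontier`), and endpoints within `δ + 7δ/10 ≤ 2δ` of the arcs;
  `PathIn.mem_siteConnIn` converts the chain into the connection event.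
* `stub_lowerCrossing`: the registered statement, by specialisation.

(Bollobás–Riordan, *Percolation* (2006), Ch. 7 Lemma 14 and Ch. 8 §8.2–8.3: the chessboard /
block discretisation of a continuum Voronoi crossing.)
-/

noncomputable section

open scoped Topology
open Filter Set MeasureTheory Metric
open Literature.Analysis.FunctionSpaces (PointConfig IsPoissonPointProcess)
open Literature.Probability.RandomPlanarGeometry (ConformalRectangle cardyFunction crossRatio)
open Literature.Probability.Percolation
  (SiteConfig sitePercolation half voronoiCrossing blackRegion PathIn)
open Summit.CriticalPhenomena.CardyFormulaZ2.Cruxes.SquareFromVoronoiHub.VoronoiBlocks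
  (zGs Gs crudeCrossing siteCrossingProb voronoiCrossingProb squareFromVoronoiHub_iff)
open Summit.CriticalPhenomena.CardyFormulaZ2.Cruxes.SquareFromVoronoiHub.VoronoiBlocks.Faithful

namespace Summit.CriticalPhenomena.CardyFormulaZ2.Cruxes.SquareFromVoronoiHub.PoissonisedChessboard

/-- **Collar sub-path shadowed by an open block chain ⇒ crude crossing.**  If a sub-path
`γ|[a,b]` (`0 ≤ a ≤ b ≤ 1`) starts within `δ` of `(ab)`, ends within `δ` of `(cd)` and runs at
distance `≥ δ` from `∂Ω` inside `Ω`, and a `Gs`-path of `ω`-open sites, all within `7δ/10` of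
`γ|[a,b]`, joins a site within `7δ/10` of `γ(a)` to a site within `7δ/10` of `γ(b)`, then
`ω ∈ crudeCrossing R δ`: the sites are in `Ω` (`mem_of_dist_lt_infDist_frontier`, `7δ/10 < δ`)
and the endpoints are within `δ + 7δ/10 ≤ 2δ` of the arcs. [folklore] -/
theorem mem_crudeCrossing_of_collar_chain (R : ConformalRectangle) {δ : ℝ} (hδ : 0 < δ)
    {ω : Set ((ℤ × ℤ) ⊕ (ℤ × ℤ))} {x y : ℂ} (γ : Path x y) {a b : ℝ}
    (ha : infDist (γ.extend a) (R.arc 0) ≤ δ) (hb : infDist (γ.extend b) (R.arc 2) ≤ δ)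
    (hin : ∀ t ∈ Icc a b, γ.extend t ∈ R.carrier ∧ δ ≤ infDist (γ.extend t) (frontier R.carrier))
    {u w : (ℤ × ℤ) ⊕ (ℤ × ℤ)} (hu : dist (γ.extend a) ((δ : ℂ) * zGs u) ≤ 7 / 10 * δ)
    (hw : dist (γ.extend b) ((δ : ℂ) * zGs w) ≤ 7 / 10 * δ)
    (hpath : PathIn Gs
      ({v | ∃ t ∈ Icc a b, dist (γ.extend t) ((δ : ℂ) * zGs v) ≤ 7 / 10 * δ} ∩ ω) u w) :
    ω ∈ crudeCrossing R δ := by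
  have hsub : {v : (ℤ × ℤ) ⊕ (ℤ × ℤ) | ∃ t ∈ Icc a b,
      dist (γ.extend t) ((δ : ℂ) * zGs v) ≤ 7 / 10 * δ} ⊆
      {v | (δ : ℂ) * zGs v ∈ R.carrier} := by
    rintro v ⟨t, ht, htv⟩
    obtain ⟨hmem, hfar⟩ := hin t ht
    refine mem_of_dist_lt_infDist_frontier R.isOpen hmem ?_
    rw [dist_comm] at htv
    linarith
  refine ⟨u, w, ?_, ?_, PathIn.mem_siteConnIn (hpath.mono (inter_subset_inter_left _ hsub))⟩
  · calc infDist ((δ : ℂ) * zGs u) (R.arc 0)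
        ≤ infDist (γ.extend a) (R.arc 0) + dist ((δ : ℂ) * zGs u) (γ.extend a) :=
          infDist_le_infDist_add_dist
      _ ≤ δ + 7 / 10 * δ := add_le_add ha (by rwa [dist_comm])
      _ ≤ 2 * δ := by linarith
  · calc infDist ((δ : ℂ) * zGs w) (R.arc 2)
        ≤ infDist (γ.extend b) (R.arc 2) + dist ((δ : ℂ) * zGs w) (γ.extend b) :=
          infDist_le_infDist_add_dist
      _ ≤ δ + 7 / 10 * δ := add_le_add hb (by rwa [dist_comm])
      _ ≤ 2 * δ := by linarith

/-- **S4 — lower inclusion of the chessboard-endpoint sandwich, deterministic part.**  At mesh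
`δ`, let `β` be a block map (points within `3δ/5` of the site of their block, points at distance
`≤ δ/4` in equal or `Gs`-adjacent blocks), `K` a set of nuclei coloured by the coins `ω₂`
(black `B = {p ∈ K | β p ∈ ω₂}`, white `W = {p ∈ K | β p ∉ ω₂}`, `B ≠ ∅`), `δ/16`-dense on
`V ⊇ closure R₁`, and ASSUME the block-chain lemma `hchain` (a black sub-path inside `V` is
shadowed within `7δ/10` by a `Gs`-path of `ω₂`-open sites with endpoints within `7δ/10` of its
endpoints).  Let `r > δ` satisfy the cap/collar clauses of `lowerMargins R R₁ F₀ F₂` (closed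
disjoint caps `F₀`, `F₂`; `F₀` at distance `≥ r` from `(cd)`, `F₂` from `(ab)`; the
`r`-neighbourhood of `closure R₁` at distance `≥ r` from `(bc)`, `(da)` with off-`closure Ω` part
inside `F₀ ∪ F₂`; the `r`-neighbourhoods of `R₁.arc 0`, `R₁.arc 2` off `closure Ω` inside `F₀`,
`F₂`), and let nothing be within `δ` of both `(ab)` and `(cd)`.  Then a BLACK continuum crossing
`γ ⊆ closure R₁` of `R₁` from `R₁.arc 0` to `R₁.arc 2` gives `ω₂ ∈ crudeCrossing R δ`: `γ`
starts off `closure Ω` in `F₀`, ends off `closure Ω` in `F₂`, hence meets `(cd)`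
(`exists_mem_arc_two_of_split`); truncated at its first entry through `(ab)`
(`exists_first_entry`) it has a collar sub-path (`exists_collar_exit`, topological input
`exists_mem_closure_of_split`), to which `hchain` and `mem_crudeCrossing_of_collar_chain` apply.
[folklore] -/
theorem mem_crudeCrossing_of_blackPath_of_chain
    (hchain : ∀ {δ : ℝ}, 0 < δ → ∀ (β : ℂ → (ℤ × ℤ) ⊕ (ℤ × ℤ)),
      (∀ p : ℂ, dist p ((δ : ℂ) * zGs (β p)) ≤ 3 / 5 * δ) →
      (∀ p q : ℂ, dist p q ≤ δ / 4 → β p = β q ∨ Gs.Adj (β p) (β q)) →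
      ∀ (ω₂ : Set ((ℤ × ℤ) ⊕ (ℤ × ℤ))) (K V : Set ℂ),
      (∀ z ∈ V, ∃ p ∈ K, dist z p < δ / 16) → {p | p ∈ K ∧ β p ∈ ω₂}.Nonempty →
      ∀ {x y : ℂ} (γ : Path x y) (a b : ℝ), 0 ≤ a → a ≤ b → b ≤ 1 →
      (∀ t ∈ Icc a b, γ.extend t ∈ V) →
      (∀ t ∈ Icc a b, γ.extend t ∈ blackRegion {p | p ∈ K ∧ β p ∈ ω₂} {p | p ∈ K ∧ β p ∉ ω₂}) →
      ∃ u w : (ℤ × ℤ) ⊕ (ℤ × ℤ), dist (γ.extend a) ((δ : ℂ) * zGs u) ≤ 7 / 10 * δ ∧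
        dist (γ.extend b) ((δ : ℂ) * zGs w) ≤ 7 / 10 * δ ∧
        PathIn Gs ({v | ∃ t ∈ Icc a b, dist (γ.extend t) ((δ : ℂ) * zGs v) ≤ 7 / 10 * δ} ∩ ω₂) u w)
    (R R₁ : ConformalRectangle) {δ : ℝ} (hδ : 0 < δ) (β : ℂ → (ℤ × ℤ) ⊕ (ℤ × ℤ))
    (hrad : ∀ p : ℂ, dist p ((δ : ℂ) * zGs (β p)) ≤ 3 / 5 * δ)
    (hadj : ∀ p q : ℂ, dist p q ≤ δ / 4 → β p = β q ∨ Gs.Adj (β p) (β q))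
    (ω₂ : Set ((ℤ × ℤ) ⊕ (ℤ × ℤ))) (K V : Set ℂ) (hdense : ∀ z ∈ V, ∃ p ∈ K, dist z p < δ / 16)
    (hV : closure R₁.carrier ⊆ V) (hne : {p | p ∈ K ∧ β p ∈ ω₂}.Nonempty)
    {F₀ F₂ : Set ℂ} {r : ℝ} (hF₀ : IsClosed F₀) (hF₂ : IsClosed F₂) (hdisj : Disjoint F₀ F₂)
    (hA : ∀ z ∈ F₀, r ≤ infDist z (R.arc 2)) (hB : ∀ z ∈ F₂, r ≤ infDist z (R.arc 0))
    (hC : ∀ z, infDist z (closure R₁.carrier) ≤ r →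
      r ≤ infDist z (R.arc 1) ∧ r ≤ infDist z (R.arc 3))
    (hD : ∀ z, infDist z (closure R₁.carrier) ≤ r → z ∉ closure R.carrier → z ∈ F₀ ∪ F₂)
    (hE : ∀ z, infDist z (R₁.arc 0) ≤ r → z ∉ closure R.carrier ∧ z ∈ F₀)
    (hF : ∀ z, infDist z (R₁.arc 2) ≤ r → z ∉ closure R.carrier ∧ z ∈ F₂)
    (hδr : δ < r) (h02 : ∀ z, infDist z (R.arc 0) ≤ δ → δ < infDist z (R.arc 2))
    {x y : ℂ} (γ : Path x y) (hx : x ∈ R₁.arc 0) (hy : y ∈ R₁.arc 2)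
    (hγ : ∀ t, γ t ∈ closure R₁.carrier)
    (hblack : ∀ t, γ t ∈ blackRegion {p | p ∈ K ∧ β p ∈ ω₂} {p | p ∈ K ∧ β p ∉ ω₂}) :
    ω₂ ∈ crudeCrossing R δ := by
  -- (i) the cap/collar bookkeeping, as in `blockConfig_mem_crudeCrossing_of_tube`
  have hδr' : δ ≤ r := hδr.le
  have hr : ∀ t, infDist (γ t) (closure R₁.carrier) ≤ r := fun t => by
    rw [infDist_zero_of_mem (hγ t)]; exact hδ.le.trans hδr'
  have hout : ∀ t, γ t ∉ closure R.carrier → γ t ∈ F₀ ∪ F₂ := fun t ht => hD _ (hr t) ht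
  have h₀ : ∀ z ∈ F₀, δ < infDist z (R.arc 2) := fun z hz => hδr.trans_le (hA z hz)
  have h₂ : ∀ z ∈ F₂, δ < infDist z (R.arc 0) := fun z hz => hδr.trans_le (hB z hz)
  have h1 : ∀ t, δ < infDist (γ t) (R.arc 1) := fun t => hδr.trans_le (hC _ (hr t)).1
  have h3 : ∀ t, δ < infDist (γ t) (R.arc 3) := fun t => hδr.trans_le (hC _ (hr t)).2
  have hx' : x ∉ closure R.carrier ∧ x ∈ F₀ :=
    hE x (by rw [infDist_zero_of_mem hx]; exact hδ.le.trans hδr')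
  have hy' : y ∉ closure R.carrier ∧ y ∈ F₂ :=
    hF y (by rw [infDist_zero_of_mem hy]; exact hδ.le.trans hδr')
  -- (ii) the path meets `(cd)`; truncate it at its first entry through `(ab)`
  obtain ⟨t₂, ht₂⟩ :=
    exists_mem_arc_two_of_split R hδ γ hF₀ hF₂ hdisj hout h₂ h1 h3 hx'.2 hy'.1 hy'.2
  have ht₂' : infDist (γ t₂) (R.arc 2) ≤ δ := by rw [infDist_zero_of_mem ht₂]; exact hδ.le
  obtain ⟨t₀, ht₀0, ht₀1, harc, -, hafter⟩ :=
    exists_first_entry R hδ γ hF₀ hF₂ hdisj hout h₀ h1 h3 hx'.1 hx'.2 ⟨t₂, ht₂'⟩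
  set γ' := γ.truncate t₀ 1 with hγ'
  have htr : ∀ s : unitInterval, ∃ t : unitInterval, γ t = γ' s := fun s =>
    γ.truncate_range (mem_range_self s)
  have hxa : infDist (γ.extend (min t₀ 1)) (R.arc 0) ≤ δ := by
    rw [min_eq_left ht₀1, infDist_zero_of_mem harc]; exact hδ.le
  have hyb : ∃ t, infDist (γ' t) (R.arc 2) ≤ δ := by
    have ht₀t₂ : t₀ ≤ t₂ := hafter t₂ t₂.2 (by rwa [Path.extend_extends'])
    refine ⟨t₂, ?_⟩
    have : γ' t₂ = γ t₂ := by
      show γ.extend (min (max (t₂ : ℝ) t₀) 1) = γ t₂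
      rw [max_eq_left ht₀t₂, min_eq_left t₂.2.2, Path.extend_extends']
    rwa [this]
  have hout' : ∀ s, γ' s ∉ closure R.carrier → γ' s ∈ F₀ ∪ F₂ := by
    intro s hs
    obtain ⟨t, ht⟩ := htr s
    rw [← ht] at hs ⊢
    exact hout t hs
  have h1' : ∀ s, δ < infDist (γ' s) (R.arc 1) := by
    intro s; obtain ⟨t, ht⟩ := htr s; rw [← ht]; exact h1 t
  have h3' : ∀ s, δ < infDist (γ' s) (R.arc 3) := by
    intro s; obtain ⟨t, ht⟩ := htr s; rw [← ht]; exact h3 t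
  -- (iii) the collar sub-path `[a, b]` of the truncated path
  obtain ⟨a, b, ha0, hab, hb1, ha, hb, hin⟩ := exists_collar_exit R hδ γ' hxa hyb
    (exists_mem_closure_of_split R γ' hF₀ hF₂ hdisj hout' h₀ h₂) h1' h3' h02
  -- its points are points of `γ`: inside `closure R₁ ⊆ V` and black
  have hpt : ∀ t ∈ Icc a b, ∃ s : unitInterval, γ s = γ'.extend t := by
    intro t ht
    have ht01 : t ∈ Icc (0 : ℝ) 1 := ⟨ha0.trans ht.1, ht.2.trans hb1⟩
    obtain ⟨s, hs⟩ := htr ⟨t, ht01⟩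
    exact ⟨s, by rw [hs, Path.extend_apply γ' ht01]⟩
  have hVt : ∀ t ∈ Icc a b, γ'.extend t ∈ V := by
    intro t ht
    obtain ⟨s, hs⟩ := hpt t ht
    rw [← hs]
    exact hV (hγ s)
  have hBt : ∀ t ∈ Icc a b,
      γ'.extend t ∈ blackRegion {p | p ∈ K ∧ β p ∈ ω₂} {p | p ∈ K ∧ β p ∉ ω₂} := by
    intro t ht
    obtain ⟨s, hs⟩ := hpt t ht
    rw [← hs]
    exact hblack s
  -- (iv) the block chain shadowing the collar sub-path, (v)-(vi) the crude crossing
  obtain ⟨u, w, hu, hw, hpath⟩ :=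
    hchain hδ β hrad hadj ω₂ K V hdense hne γ' a b ha0 hab.le hb1 hVt hBt
  exact mem_crudeCrossing_of_collar_chain R hδ γ' ha hb hin hu hw hpath

/-- **Registered stub `stub_lowerCrossing`** (S4, lower inclusion of the chessboard-endpoint
sandwich, deterministic): given the block-chain lemma (first hypothesis, = `stub_blockChain`),
a black continuum crossing of the lower perturbed rectangle `R₁` (caps `F₀`, `F₂`, margin
`r > δ` as in `lowerMargins R R₁ F₀ F₂`) puts the coin configuration `ω₂` in
`crudeCrossing R δ`; the statement of `mem_crudeCrossing_of_blackPath_of_chain`.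
(S4, registered) [folklore] -/
theorem stub_lowerCrossing : (∀ {δ : ℝ}, 0 < δ → ∀ (β : ℂ → (ℤ × ℤ) ⊕ (ℤ × ℤ)),
      (∀ p : ℂ, dist p ((δ : ℂ) * zGs (β p)) ≤ 3 / 5 * δ) →
      (∀ p q : ℂ, dist p q ≤ δ / 4 → β p = β q ∨ Gs.Adj (β p) (β q)) →
      ∀ (ω₂ : Set ((ℤ × ℤ) ⊕ (ℤ × ℤ))) (K V : Set ℂ),
      (∀ z ∈ V, ∃ p ∈ K, dist z p < δ / 16) → {p | p ∈ K ∧ β p ∈ ω₂}.Nonempty →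
      ∀ {x y : ℂ} (γ : Path x y) (a b : ℝ), 0 ≤ a → a ≤ b → b ≤ 1 →
      (∀ t ∈ Icc a b, γ.extend t ∈ V) →
      (∀ t ∈ Icc a b, γ.extend t ∈ blackRegion {p | p ∈ K ∧ β p ∈ ω₂} {p | p ∈ K ∧ β p ∉ ω₂}) →
      ∃ u w : (ℤ × ℤ) ⊕ (ℤ × ℤ), dist (γ.extend a) ((δ : ℂ) * zGs u) ≤ 7 / 10 * δ ∧
        dist (γ.extend b) ((δ : ℂ) * zGs w) ≤ 7 / 10 * δ ∧
        PathIn Gs ({v | ∃ t ∈ Icc a b, dist (γ.extend t) ((δ : ℂ) * zGs v) ≤ 7 / 10 * δ} ∩ ω₂) u w) →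
    ∀ (R R₁ : ConformalRectangle) {δ : ℝ}, 0 < δ → ∀ (β : ℂ → (ℤ × ℤ) ⊕ (ℤ × ℤ)),
      (∀ p : ℂ, dist p ((δ : ℂ) * zGs (β p)) ≤ 3 / 5 * δ) →
      (∀ p q : ℂ, dist p q ≤ δ / 4 → β p = β q ∨ Gs.Adj (β p) (β q)) →
      ∀ (ω₂ : Set ((ℤ × ℤ) ⊕ (ℤ × ℤ))) (K V : Set ℂ),
      (∀ z ∈ V, ∃ p ∈ K, dist z p < δ / 16) → closure R₁.carrier ⊆ V →
      {p | p ∈ K ∧ β p ∈ ω₂}.Nonempty →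
      ∀ {F₀ F₂ : Set ℂ} {r : ℝ}, IsClosed F₀ → IsClosed F₂ → Disjoint F₀ F₂ →
      (∀ z ∈ F₀, r ≤ infDist z (R.arc 2)) → (∀ z ∈ F₂, r ≤ infDist z (R.arc 0)) →
      (∀ z, infDist z (closure R₁.carrier) ≤ r → r ≤ infDist z (R.arc 1) ∧ r ≤ infDist z (R.arc 3)) →
      (∀ z, infDist z (closure R₁.carrier) ≤ r → z ∉ closure R.carrier → z ∈ F₀ ∪ F₂) →
      (∀ z, infDist z (R₁.arc 0) ≤ r → z ∉ closure R.carrier ∧ z ∈ F₀) →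
      (∀ z, infDist z (R₁.arc 2) ≤ r → z ∉ closure R.carrier ∧ z ∈ F₂) →
      δ < r → (∀ z, infDist z (R.arc 0) ≤ δ → δ < infDist z (R.arc 2)) →
      ∀ {x y : ℂ} (γ : Path x y), x ∈ R₁.arc 0 → y ∈ R₁.arc 2 → (∀ t, γ t ∈ closure R₁.carrier) →
      (∀ t, γ t ∈ blackRegion {p | p ∈ K ∧ β p ∈ ω₂} {p | p ∈ K ∧ β p ∉ ω₂}) →
      ω₂ ∈ crudeCrossing R δ :=
  fun hchain R R₁ _ hδ β hrad hadj ω₂ K V hdense hV hne _ _ _ hF₀ hF₂ hdisj hA hB hC hD hE hF hδr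
      h02 _ _ γ hx hy hγ hblack =>
    mem_crudeCrossing_of_blackPath_of_chain hchain R R₁ hδ β hrad hadj ω₂ K V hdense hV hne hF₀ hF₂
      hdisj hA hB hC hD hE hF hδr h02 γ hx hy hγ hblack

end Summit.CriticalPhenomena.CardyFormulaZ2.Cruxes.SquareFromVoronoiHub.PoissonisedChessboard

end
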